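import Mathlib
import Literature.Analysis.ODE.InverseCoordSmooth
import Literature.Analysis.PDE.Wave1DExteriorEnergy
import Literature.Analysis.PDE.Wave1DFarEnergyLimits
import Literature.Analysis.PDE.Wave1DSpatialReflection
import Literature.Analysis.PDE.FarChannelsTrueKernel
import Literature.Analysis.PDE.FarChannelsTrueSpan
import Literature.Analysis.PDE.FarChannelsTrueSpanTransfer
import Literature.Analysis.PDE.FarChannelsCutoffData
import Literature.Analysis.PDE.InverseSquareExactChannelBound
import Literature.Analysis.PDE.FarChannelsStep
import Literature.Analysis.PDE.FarChannelsAssemblyLemmas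
import Literature.Analysis.PDE.FarKernelSpanLemmas
import HarnessLib

/-!
# Far half-line channel of energy for `ψ_tt − ψ_xx + Vψ = 0` with an inverse-square far end

Analysis/PDE file (everything proved, no definitions). For `ℓ ≥ 1` and a continuous potential
`V ≥ 0` on the line with `|V(y) − ℓ(ℓ+1)/y²| ≤ A y^{-5/2}` for `y ≥ y₀ ≥ 1`, there are `ρ₀ ≥ 0`,
`c > 0` such that for every `ρ ≥ ρ₀` and every global `C²` solution `ψ` the two time-ended channel
energy on the far cone `{y > ρ + |t|}` controls `c · inf_p E[ψ − p; y > ρ, t = 0]` over the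
`t`-polynomial `C²` solutions `p` on the cone (`farChannels_of_inverseSquareTail`). This is the
`x_c = 0` form of the FAR hypothesis of
`Summit.FinalStateConjecture.FinalStateConjecture.Theorems.fixedModeChannels_of_near_far`
(route PhotonSphereChannels, `FixedModeChannels`, stmt-FinalStateConjecture-10048).

Proof: `P ⊇ Q = {Q_{a,b}}`, the span of the true kernel towers (`FarChannelsTrueKernel`,
`FarChannelsTrueSpan`); for a near-minimiser `Q* ∈ Q` of `E[ψ − ·]` apply the step estimate
`farStep` to `φ = ψ − Q*` with cut-off size `θ`; by linearity of `Q` the left side is again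
`≥ inf_Q`, the channel energies of `φ` are at most twice those of `ψ` (the towers do not radiate),
and the `D_r/ρ` term is absorbed for `ρ ≥ 2C₃ + 2`; let `θ → 0`. Infinite initial energy is handled
by `wave1D_farEnergy_eq_top_of_initial_eq_top`. Folklore; the exact (`A = 0`) statement is the
exterior channel estimate of Kenig–Lawrie–Liu–Schlag (Adv. Math. 285 (2015)) in odd dimensions.
-/

noncomputable section

namespace Literature.Analysis.PDE

open MeasureTheory Set Filter Topology Finset Literature.Analysis.ODE
open scoped ENNReal

variable {V : ℝ → ℝ}

/-- **Far channel estimate, centered potential with inverse-square tail.** See the module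
docstring. [cite: KenigEtAl2015, Thm 1 (exterior channel, exact kernel); folklore (perturbation)] -/
theorem farChannels_of_inverseSquareTail (ℓ : ℕ) (hℓ : 1 ≤ ℓ) (hV : Continuous V)
    (hV0 : ∀ x, 0 ≤ V x) {A y₀ : ℝ} (hy₀ : 1 ≤ y₀)
    (hVb : ∀ y, y₀ ≤ y → |V y - ℓ * (ℓ + 1) / y ^ 2| ≤ A * y ^ (-(5 / 2 : ℝ))) :
    ∃ ρ₀ : ℝ, 0 ≤ ρ₀ ∧ ∃ c : ℝ, 0 < c ∧ ∀ ρ : ℝ, ρ₀ ≤ ρ → ∀ ψ : ℝ → ℝ → ℝ,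
      ContDiff ℝ 2 (Function.uncurry ψ) →
      (∀ t x, iteratedDeriv 2 (fun τ => ψ τ x) t - iteratedDeriv 2 (ψ t) x + V x * ψ t x = 0) →
      ENNReal.ofReal c *
        (⨅ p ∈ {p : ℝ → ℝ → ℝ | ContDiffOn ℝ 2 (Function.uncurry p) {z : ℝ × ℝ | ρ + |z.1| < z.2} ∧
            (∀ z ∈ {z : ℝ × ℝ | ρ + |z.1| < z.2}, iteratedDeriv 2 (fun τ => p τ z.2) z.1
              - iteratedDeriv 2 (p z.1) z.2 + V z.2 * p z.1 z.2 = 0) ∧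
            ∃ (N : ℕ) (a : ℕ → ℝ → ℝ), ∀ z ∈ {z : ℝ × ℝ | ρ + |z.1| < z.2},
              p z.1 z.2 = ∑ i ∈ Finset.range N, a i z.2 * z.1 ^ i},
          ∫⁻ x in Ioi ρ, ENNReal.ofReal (deriv (fun τ => ψ τ x - p τ x) 0 ^ 2
            + deriv (fun y => ψ 0 y - p 0 y) x ^ 2 + V x * (ψ 0 x - p 0 x) ^ 2))
      ≤ liminf (fun t => ∫⁻ x in Ioi (ρ + |t|), ENNReal.ofReal
            (deriv (fun τ => ψ τ x) t ^ 2 + deriv (ψ t) x ^ 2 + V x * ψ t x ^ 2)) atTop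
        + liminf (fun t => ∫⁻ x in Ioi (ρ + |t|), ENNReal.ofReal
            (deriv (fun τ => ψ τ x) t ^ 2 + deriv (ψ t) x ^ 2 + V x * ψ t x ^ 2)) atBot := by
  -- the coordinate `ι` and the tail bound in `ι`-form
  obtain ⟨ι, hι, hιeq, hric, I, hI, hI'⟩ := exists_smooth_inv_extension
  have hL2 : (2 : ℝ) ≤ ℓ * (ℓ + 1) := by
    have : (1 : ℝ) ≤ ℓ := by exact_mod_cast hℓ
    nlinarith
  have hVbι : ∀ x, y₀ ≤ x → |V x - ℓ * (ℓ + 1) * ι x ^ 2| ≤ A * x ^ (-(5 / 2 : ℝ)) := by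
    intro x hx
    rw [hιeq x (by linarith), inv_pow, ← div_eq_mul_inv]
    exact hVb x hx
  -- the true towers and the transfer constant
  obtain ⟨E, x₁, K, hx₁, hK0, hEC, -, hEb, hTC, hTwave, hTdata, hTenergy⟩ :=
    exists_farTrueTowers hι hιeq hV hV0 ℓ hℓ hy₀ hVbι
  have hx₁1 : 1 ≤ x₁ := hy₀.trans hx₁
  have hVW : ∀ x, x₁ ≤ x → V x ≤ (ℓ * (ℓ + 1) + |A|) * x ^ (-(2 : ℝ)) := by
    intro x hx
    have hx1 : 1 ≤ x := hx₁1.trans hx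
    have hx0 : 0 < x := by linarith
    have hb := (abs_le.1 (hVbι x (hx₁.trans hx))).2
    have hw : ι x ^ 2 = x ^ (-(2 : ℝ)) := by
      rw [hιeq x (by linarith), Real.rpow_neg hx0.le, Real.rpow_two, inv_pow]
    have h52 : x ^ (-(5 / 2 : ℝ)) ≤ x ^ (-(2 : ℝ)) :=
      Real.rpow_le_rpow_of_exponent_le hx1 (by norm_num)
    have h0 : 0 ≤ x ^ (-(5 / 2 : ℝ)) := Real.rpow_nonneg hx0.le _
    rw [hw] at hb
    nlinarith [le_abs_self A, mul_le_mul_of_nonneg_left h52 (abs_nonneg A), abs_nonneg A]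
  obtain ⟨Kf, hKf0, hKf⟩ := farTrueSpan_transfer hι hιeq hℓ hx₁1
    (by positivity : (0 : ℝ) ≤ ℓ * (ℓ + 1) + |A|) hEC hEb hV hV0 hVW
  obtain ⟨Cc, hCc0, hCutAll⟩ := exists_cutoffData
  obtain ⟨C_A, hCA0, hA2⟩ := exists_exactWave_channel_bound hι hιeq hric hI hI' ℓ
  -- the span `Q_{a,b}`
  set T : ℕ → ℝ → ℝ → ℝ := fun m t x =>
    ∑ i ∈ range (m + 1), (m.choose i : ℝ) * E (m - i) x * t ^ i with hT
  set Q : (ℕ → ℝ) → (ℕ → ℝ) → ℝ → ℝ → ℝ := fun a b t x =>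
    ∑ k ∈ range (ℓ / 2 + 1), a k / (∏ i ∈ range ℓ, (((2 * k : ℕ) : ℝ) - 2 * i - 1)) * T (2 * k) t x
      + ∑ k ∈ range ((ℓ + 1) / 2), b k / (((2 * k + 1 : ℕ) : ℝ) * ∏ i ∈ range ℓ, (((2 * k : ℕ) : ℝ) - 2 * i - 1)) * T (2 * k + 1) t x
    with hQ
  have hTC' : ∀ m, m ≤ ℓ → ContDiff ℝ 2 (Function.uncurry (T m)) := fun m hm => hTC m hm
  have hTwave' : ∀ m, m ≤ ℓ → ∀ t x, 1 / 2 < x →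
      iteratedDeriv 2 (fun τ => T m τ x) t - iteratedDeriv 2 (T m t) x + V x * T m t x = 0 :=
    fun m hm t x hx => hTwave m hm t hx
  have hTdata' : ∀ m, m ≤ ℓ → ∀ x,
      T m 0 x = E m x ∧ deriv (fun τ => T m τ x) 0 = (m : ℝ) * E (m - 1) x :=
    fun m hm x => hTdata m hm x
  have hbasic := fun a b => farTrueSpan_basic (V := V) (T := T) (E := E) (ℓ := ℓ)
    (fun m t x => rfl) hTC' hTwave' hTdata' a b (Q := Q a b) (fun t x => rfl)
  have hQC : ∀ a b, ContDiff ℝ 2 (Function.uncurry (Q a b)) := fun a b => (hbasic a b).1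
  have hka : ∀ k, k ∈ range (ℓ / 2 + 1) → 2 * k ≤ ℓ := fun k hk => by
    have := mem_range.1 hk; omega
  have hkb : ∀ k, k ∈ range ((ℓ + 1) / 2) → 2 * k + 1 ≤ ℓ := fun k hk => by
    have := mem_range.1 hk; omega
  have hQen : ∀ a b ρ, x₁ ≤ ρ →
      Tendsto (fun t => ∫⁻ z in Ioi (ρ + |t|), ENNReal.ofReal (deriv (fun τ => (Q a b) τ z) t ^ 2 + deriv ((Q a b) t) z ^ 2 + V z * (Q a b) t z ^ 2)) atTop (𝓝 0) ∧
      Tendsto (fun t => ∫⁻ z in Ioi (ρ + |t|), ENNReal.ofReal (deriv (fun τ => (Q a b) τ z) t ^ 2 + deriv ((Q a b) t) z ^ 2 + V z * (Q a b) t z ^ 2)) atBot (𝓝 0) ∧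
      ∫⁻ z in Ioi ρ, ENNReal.ofReal (deriv (fun τ => (Q a b) τ z) 0 ^ 2 + deriv ((Q a b) 0) z ^ 2 + V z * (Q a b) 0 z ^ 2) < ⊤ := by
    intro a b ρ hρ
    exact lincomb2_farEnergy (V := V) hV0 (u₁ := range (ℓ / 2 + 1)) (u₂ := range ((ℓ + 1) / 2))
      (B₁ := fun k => T (2 * k)) (B₂ := fun k => T (2 * k + 1))
      (fun k => a k / ∏ i ∈ range ℓ, (((2 * k : ℕ) : ℝ) - 2 * i - 1))
      (fun k => b k / (((2 * k + 1 : ℕ) : ℝ) * ∏ i ∈ range ℓ, (((2 * k : ℕ) : ℝ) - 2 * i - 1)))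
      (fun k hk => hTC _ (hka k hk)) (fun k hk => hTC _ (hkb k hk))
      (fun k hk => hTenergy _ (hka k hk) ρ hρ) (fun k hk => hTenergy _ (hkb k hk) ρ hρ)
      (Q := Q a b) (fun t x => rfl)
  have hQadd : ∀ a b a' b' t x, Q (fun k => a k + a' k) (fun k => b k + b' k) t x
      = Q a b t x + Q a' b' t x := by
    intro a b a' b' t x
    simp only [hQ, add_div, add_mul, Finset.sum_add_distrib]
    ring
  have hQzero : Q (fun _ => 0) (fun _ => 0) = fun _ _ => 0 := by
    funext t x; simp [hQ]
  -- constants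
  set C₁ : ℝ := 3 + 96 * C_A * (1 + Kf) with hC₁
  set C₂ : ℝ := 24 * C_A * (1 + Kf) + 1 with hC₂
  set C₃ : ℝ := Cc * (1536 * C_A * (1 + Kf) * A ^ 2 + 12 * Kf) with hC₃
  have hKf1 : (0 : ℝ) ≤ 1 + Kf := by linarith only [hKf0]
  have hC₁0 : 0 < C₁ := by
    have h1 : 0 ≤ 96 * C_A * (1 + Kf) := mul_nonneg (mul_nonneg (by norm_num) hCA0) hKf1
    simp only [hC₁]; linarith only [h1]
  have hC₂0 : 0 < C₂ := by
    have h1 : 0 ≤ 24 * C_A * (1 + Kf) := mul_nonneg (mul_nonneg (by norm_num) hCA0) hKf1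
    simp only [hC₂]; linarith only [h1]
  have hC₃0 : 0 ≤ C₃ := mul_nonneg hCc0 (add_nonneg (mul_nonneg (mul_nonneg (mul_nonneg
    (by norm_num) hCA0) hKf1) (sq_nonneg A)) (mul_nonneg (by norm_num) hKf0))
  have hcpos : 0 < 1 / (4 * C₂) := by
    apply div_pos one_pos; linarith only [hC₂0]
  set ρV : ℝ := max y₀ ((|A| + 1) ^ 2) with hρV
  refine ⟨max (max x₁ ρV) (2 * C₃ + 2), le_trans (by linarith only [hC₃0]) (le_max_right _ _),
    1 / (4 * C₂), hcpos, ?_⟩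
  intro ρ hρ ψ hψ hsol
  have hρx : x₁ ≤ ρ := le_trans (le_max_left _ _) ((le_max_left _ _).trans hρ)
  have hρV' : ρV ≤ ρ := le_trans (le_max_right _ _) ((le_max_left _ _).trans hρ)
  have hρC : 2 * C₃ + 2 ≤ ρ := (le_max_right _ _).trans hρ
  have hρ1 : 1 ≤ ρ := hx₁1.trans hρx
  have hρ0 : 0 < ρ := by linarith
  have hy₀ρ : y₀ ≤ ρ := (le_max_left _ _).trans hρV'
  have hV23 : ∀ x, ρ ≤ x → (ℓ : ℝ) * (ℓ + 1) * ι x ^ 2 ≤ 2 * V x ∧ V x ≤ 2 * ((ℓ : ℝ) * (ℓ + 1) * ι x ^ 2) :=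
    fun x hx => inverseSquareTail_sandwich hL2 hy₀ hιeq hVbι (hρV'.trans hx)
  have hVA : ∀ x, ρ ≤ x → |V x - ℓ * (ℓ + 1) * ι x ^ 2| ≤ A * x ^ (-(5 / 2 : ℝ)) :=
    fun x hx => hVbι x (hy₀ρ.trans hx)
  have hVlow : ∀ x, ρ ≤ x → (x ^ 2)⁻¹ ≤ V x := by
    intro x hx
    have hx0 : 0 < x := by linarith
    have h := (hV23 x hx).1
    rw [hιeq x (by linarith), inv_pow] at h
    have h0 : 0 ≤ (x ^ 2)⁻¹ := inv_nonneg.2 (sq_nonneg x)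
    have h' := mul_le_mul_of_nonneg_right hL2 h0
    linarith only [h, h']
  -- the objects of the statement
  set S : Set (ℝ → ℝ → ℝ) := {p : ℝ → ℝ → ℝ | ContDiffOn ℝ 2 (Function.uncurry p)
      {z : ℝ × ℝ | ρ + |z.1| < z.2} ∧
      (∀ z ∈ {z : ℝ × ℝ | ρ + |z.1| < z.2}, iteratedDeriv 2 (fun τ => p τ z.2) z.1
        - iteratedDeriv 2 (p z.1) z.2 + V z.2 * p z.1 z.2 = 0) ∧
      ∃ (N : ℕ) (a : ℕ → ℝ → ℝ), ∀ z ∈ {z : ℝ × ℝ | ρ + |z.1| < z.2},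
        p z.1 z.2 = ∑ i ∈ Finset.range N, a i z.2 * z.1 ^ i} with hS
  set F : (ℝ → ℝ → ℝ) → ENNReal := fun p => ∫⁻ x in Ioi ρ, ENNReal.ofReal (deriv (fun τ => ψ τ x - p τ x) 0 ^ 2
            + deriv (fun y => ψ 0 y - p 0 y) x ^ 2 + V x * (ψ 0 x - p 0 x) ^ 2) with hF
  set Λp : ENNReal := liminf (fun t => ∫⁻ x in Ioi (ρ + |t|), ENNReal.ofReal
            (deriv (fun τ => ψ τ x) t ^ 2 + deriv (ψ t) x ^ 2 + V x * ψ t x ^ 2)) atTop with hΛp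
  set Λm : ENNReal := liminf (fun t => ∫⁻ x in Ioi (ρ + |t|), ENNReal.ofReal
            (deriv (fun τ => ψ τ x) t ^ 2 + deriv (ψ t) x ^ 2 + V x * ψ t x ^ 2)) atBot with hΛm
  show ENNReal.ofReal (1 / (4 * C₂)) * (⨅ p ∈ S, F p) ≤ Λp + Λm
  -- the span lies in `S`
  have hmem : ∀ a b, Q a b ∈ S := by
    intro a b
    refine ⟨(hQC a b).contDiffOn, fun z hz => (hbasic a b).2.1 z.1 z.2 ?_, ?_⟩
    · have h : ρ + |z.1| < z.2 := hz
      linarith only [h, abs_nonneg z.1, hρ1]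
    · obtain ⟨co, hco⟩ := (hbasic a b).2.2.1
      exact ⟨ℓ + 1, co, fun z _ => hco z.1 z.2⟩
  set DQ : ENNReal := ⨅ ab : (ℕ → ℝ) × (ℕ → ℝ), F (Q ab.1 ab.2) with hDQ
  have hinfP : (⨅ p ∈ S, F p) ≤ DQ := le_iInf fun ab => iInf₂_le (Q ab.1 ab.2) (hmem ab.1 ab.2)
  have h4C₂ : ENNReal.ofReal (4 * C₂) ≠ 0 :=
    (ENNReal.ofReal_pos.2 (by linarith only [hC₂0] : (0 : ℝ) < 4 * C₂)).ne'
  suffices hclaim : DQ ≤ ENNReal.ofReal (4 * C₂) * (Λp + Λm) by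
    calc ENNReal.ofReal (1 / (4 * C₂)) * (⨅ p ∈ S, F p)
        ≤ ENNReal.ofReal (1 / (4 * C₂)) * DQ := mul_le_mul' le_rfl hinfP
      _ ≤ ENNReal.ofReal (1 / (4 * C₂)) * (ENNReal.ofReal (4 * C₂) * (Λp + Λm)) :=
          mul_le_mul' le_rfl hclaim
      _ = Λp + Λm := by
          rw [← mul_assoc, ← ENNReal.ofReal_mul hcpos.le,
            show 1 / (4 * C₂) * (4 * C₂) = 1 by field_simp, ENNReal.ofReal_one, one_mul]
  -- measurability and the elementary splitting of the channel energies
  have hmeasψ : ∀ t, Measurable fun x => ENNReal.ofReal (deriv (fun τ => ψ τ x) t ^ 2 + deriv (ψ t) x ^ 2 + V x * ψ t x ^ 2) := fun t =>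
    ENNReal.measurable_ofReal.comp ((continuous_wave1D_energyDensity hV hψ).comp
      (continuous_const.prodMk continuous_id)).measurable
  by_cases htop : ∫⁻ x in Ioi ρ, ENNReal.ofReal (deriv (fun τ => ψ τ x) 0 ^ 2 + deriv (ψ 0) x ^ 2 + V x * ψ 0 x ^ 2) = ⊤
  · -- infinite initial energy: the channel energies are infinite
    have hall := wave1D_farEnergy_eq_top_of_initial_eq_top hV hV0 hψ hsol htop
    have hΛp' : Λp = ⊤ := by simp only [hΛp, hall, liminf_const]
    rw [hΛp', top_add, ENNReal.mul_top h4C₂]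
    exact le_top
  -- finite initial energy
  have hEtop : ∫⁻ x in Ioi ρ, ENNReal.ofReal (deriv (fun τ => ψ τ x) 0 ^ 2 + deriv (ψ 0) x ^ 2 + V x * ψ 0 x ^ 2) < ⊤ := lt_top_iff_ne_top.2 htop
  have hF0 : F (Q (fun _ => 0) (fun _ => 0)) ≤ ∫⁻ x in Ioi ρ, ENNReal.ofReal (deriv (fun τ => ψ τ x) 0 ^ 2 + deriv (ψ 0) x ^ 2 + V x * ψ 0 x ^ 2) := by
    simp only [hF, hQzero, sub_zero]
    exact le_rfl
  have hDQtop : DQ < ⊤ :=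
    lt_of_le_of_lt ((iInf_le _ ((fun _ => (0 : ℝ)), (fun _ => (0 : ℝ)))).trans hF0) hEtop
  refine ENNReal.le_of_forall_pos_le_add fun ε hε hfin => ?_
  have hΛtop : Λp + Λm < ⊤ := by
    by_contra h
    rw [not_lt, top_le_iff] at h
    rw [h, ENNReal.mul_top h4C₂] at hfin
    exact lt_irrefl _ hfin
  have hΛptop : Λp ≠ ⊤ := (lt_of_le_of_lt le_self_add hΛtop).ne
  have hΛmtop : Λm ≠ ⊤ := (lt_of_le_of_lt le_add_self hΛtop).ne
  set θ : ℝ := (ε : ℝ) / (4 * C₁) with hθ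
  have hε0 : (0 : ℝ) < ε := by exact_mod_cast hε
  have hθpos : 0 < θ := div_pos hε0 (by linarith only [hC₁0])
  -- a near-minimiser in the span
  have hε2 : (ε : ENNReal) / 2 ≠ 0 := (ENNReal.half_pos (by exact_mod_cast hε.ne')).ne'
  obtain ⟨⟨a₀, b₀⟩, hlt⟩ : ∃ ab : (ℕ → ℝ) × (ℕ → ℝ), F (Q ab.1 ab.2) < DQ + (ε : ENNReal) / 2 :=
    iInf_lt_iff.1 (ENNReal.lt_add_right hDQtop.ne hε2)
  set φ : ℝ → ℝ → ℝ := fun t x => ψ t x - Q a₀ b₀ t x with hφ_def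
  have hφC : ContDiff ℝ 2 (Function.uncurry φ) := hψ.sub (hQC a₀ b₀)
  have hφres : ∀ t x, 1 / 2 < x →
      iteratedDeriv 2 (fun τ => φ τ x) t - iteratedDeriv 2 (φ t) x + V x * φ t x = 0 := by
    intro t x hx
    have s1 := contDiff_two_slices'' hψ t x
    have s2 := contDiff_two_slices'' (hQC a₀ b₀) t x
    show iteratedDeriv 2 (fun τ => ψ τ x - Q a₀ b₀ τ x) t
      - iteratedDeriv 2 (fun y => ψ t y - Q a₀ b₀ t y) x + V x * (ψ t x - Q a₀ b₀ t x) = 0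
    rw [iteratedDeriv_fun_sub (n := 2) s1.1.contDiffAt s2.1.contDiffAt,
      iteratedDeriv_fun_sub (n := 2) s1.2.contDiffAt s2.2.contDiffAt]
    have e1 := hsol t x
    have e2 := (hbasic a₀ b₀).2.1 t x hx
    linear_combination e1 - e2
  have hFφtop : F (Q a₀ b₀) < ⊤ :=
    hlt.trans (ENNReal.add_lt_top.2 ⟨hDQtop, ENNReal.div_lt_top ENNReal.coe_ne_top two_ne_zero⟩)
  have hφfinE : ∫⁻ x in Ioi ρ, ENNReal.ofReal (deriv (fun τ => φ τ x) 0 ^ 2 + deriv (φ 0) x ^ 2 + V x * φ 0 x ^ 2) < ⊤ := hFφtop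
  have hφcont : Continuous fun x =>
      deriv (fun τ => φ τ x) 0 ^ 2 + deriv (φ 0) x ^ 2 + V x * φ 0 x ^ 2 :=
    (continuous_wave1D_energyDensity hV hφC).comp (continuous_const.prodMk continuous_id)
  obtain ⟨hφint, hφeq⟩ := integrableOn_Ioi_of_lintegral_lt_top hφcont
    (fun x => wave1D_energyDensity_nonneg hV0 0 x) hφfinE
  -- the step estimate for `φ`
  obtain ⟨a, b, hstep⟩ := farStep (φ := φ) (Q := Q) (A := A) hV hV0 hι hιeq hℓ hρ1 hVA
    (fun x hx => (hV23 x hx).1) (fun x hx => (hV23 x hx).2) hCc0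
    (fun {f} {g} hf hg hi {θ'} hθ' => hCutAll hV hV0 hρ1 hVlow hf hg hi hθ') hCA0 hA2 hKf0
    (fun a b Q' h0 h1 hk => hKf a b ρ hρx Q' h0 h1 hk) hQC (fun a b => (hbasic a b).2.2.2.1)
    (fun a b => (hbasic a b).2.2.2.2) hφC hφres hφint hθpos
  clear hA2 hKf hCutAll hTenergy hTwave hTdata hTwave' hTdata' hTC hTC' hEb hbasic hmem hinfP
  -- the left side is again an element of the span
  have hlhs : F (Q (fun k => a₀ k + a k) (fun k => b₀ k + b k))
      = ∫⁻ x in Ioi ρ, ENNReal.ofReal (deriv (fun τ => φ τ x - Q a b τ x) 0 ^ 2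
          + deriv (fun y => φ 0 y - Q a b 0 y) x ^ 2 + V x * (φ 0 x - Q a b 0 x) ^ 2) := by
    simp only [hF]
    refine lintegral_congr fun x => ?_
    have e1 : (fun τ => ψ τ x - Q (fun k => a₀ k + a k) (fun k => b₀ k + b k) τ x)
        = fun τ => φ τ x - Q a b τ x := by
      funext τ; simp only [hφ_def, hQadd]; ring
    have e2 : (fun y => ψ 0 y - Q (fun k => a₀ k + a k) (fun k => b₀ k + b k) 0 y)
        = fun y => φ 0 y - Q a b 0 y := by
      funext y; simp only [hφ_def, hQadd]; ring
    have e3 : ψ 0 x - Q (fun k => a₀ k + a k) (fun k => b₀ k + b k) 0 x = φ 0 x - Q a b 0 x := by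
      simp only [hφ_def, hQadd]; ring
    rw [e1, e2, e3]
  have hDQle : DQ ≤ F (Q (fun k => a₀ k + a k) (fun k => b₀ k + b k)) :=
    iInf_le (fun ab : (ℕ → ℝ) × (ℕ → ℝ) => F (Q ab.1 ab.2)) ((fun k => a₀ k + a k), (fun k => b₀ k + b k))
  -- the channel energies of `φ` are at most twice those of `ψ`
  have hsl : ∀ (χ : ℝ → ℝ → ℝ), ContDiff ℝ 2 (Function.uncurry χ) → ∀ t x,
      DifferentiableAt ℝ (fun τ => χ τ x) t ∧ DifferentiableAt ℝ (χ t) x := fun χ hχ t x =>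
    ⟨(contDiff_two_slices'' hχ t x).1.differentiable (by norm_num) t,
      (contDiff_two_slices'' hχ t x).2.differentiable (by norm_num) x⟩
  have hptφ : ∀ t x, deriv (fun τ => φ τ x) t ^ 2 + deriv (φ t) x ^ 2 + V x * φ t x ^ 2
      ≤ 2 * (deriv (fun τ => ψ τ x) t ^ 2 + deriv (ψ t) x ^ 2 + V x * ψ t x ^ 2) + 2 * (deriv (fun τ => (Q a₀ b₀) τ x) t ^ 2 + deriv ((Q a₀ b₀) t) x ^ 2 + V x * (Q a₀ b₀) t x ^ 2) := by
    intro t x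
    show deriv (fun τ => ψ τ x - Q a₀ b₀ τ x) t ^ 2 + deriv (fun y => ψ t y - Q a₀ b₀ t y) x ^ 2
      + V x * (ψ t x - Q a₀ b₀ t x) ^ 2 ≤ _
    rw [deriv_fun_sub (hsl ψ hψ t x).1 (hsl _ (hQC a₀ b₀) t x).1,
      deriv_fun_sub (hsl ψ hψ t x).2 (hsl _ (hQC a₀ b₀) t x).2]
    have hVx := hV0 x
    linarith only [sq_nonneg (deriv (fun τ => ψ τ x) t + deriv (fun τ => Q a₀ b₀ τ x) t),
      sq_nonneg (deriv (ψ t) x + deriv (Q a₀ b₀ t) x),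
      mul_nonneg hVx (sq_nonneg (ψ t x + Q a₀ b₀ t x))]
  have hΛφ : ∀ (Fl : Filter ℝ) [Fl.NeBot],
      Tendsto (fun t => ∫⁻ z in Ioi (ρ + |t|), ENNReal.ofReal (deriv (fun τ => (Q a₀ b₀) τ z) t ^ 2 + deriv ((Q a₀ b₀) t) z ^ 2 + V z * (Q a₀ b₀) t z ^ 2)) Fl (𝓝 0) →
      liminf (fun t => ∫⁻ x in Ioi (ρ + |t|), ENNReal.ofReal (deriv (fun τ => φ τ x) t ^ 2 + deriv (φ t) x ^ 2 + V x * φ t x ^ 2)) Fl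
        ≤ 2 * liminf (fun t => ∫⁻ x in Ioi (ρ + |t|), ENNReal.ofReal (deriv (fun τ => ψ τ x) t ^ 2 + deriv (ψ t) x ^ 2 + V x * ψ t x ^ 2)) Fl := by
    intro Fl _ hw
    refine ENNReal.liminf_le_two_mul_of_le (fun t => ?_) hw
    calc ∫⁻ x in Ioi (ρ + |t|), ENNReal.ofReal (deriv (fun τ => φ τ x) t ^ 2 + deriv (φ t) x ^ 2 + V x * φ t x ^ 2)
        ≤ ∫⁻ x in Ioi (ρ + |t|), (2 * ENNReal.ofReal (deriv (fun τ => ψ τ x) t ^ 2 + deriv (ψ t) x ^ 2 + V x * ψ t x ^ 2)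
          + 2 * ENNReal.ofReal (deriv (fun τ => (Q a₀ b₀) τ x) t ^ 2 + deriv ((Q a₀ b₀) t) x ^ 2 + V x * (Q a₀ b₀) t x ^ 2)) := by
          refine lintegral_mono fun x => ?_
          rw [show (2 : ENNReal) = ENNReal.ofReal 2 by norm_num, ← ENNReal.ofReal_mul (by norm_num),
            ← ENNReal.ofReal_mul (by norm_num), ← ENNReal.ofReal_add
              (mul_nonneg zero_le_two (wave1D_energyDensity_nonneg hV0 t x))
              (mul_nonneg zero_le_two (wave1D_energyDensity_nonneg (ψ := Q a₀ b₀) hV0 t x))]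
          exact ENNReal.ofReal_le_ofReal (hptφ t x)
      _ = 2 * (∫⁻ x in Ioi (ρ + |t|), ENNReal.ofReal (deriv (fun τ => ψ τ x) t ^ 2 + deriv (ψ t) x ^ 2 + V x * ψ t x ^ 2))
          + 2 * (∫⁻ x in Ioi (ρ + |t|), ENNReal.ofReal (deriv (fun τ => (Q a₀ b₀) τ x) t ^ 2 + deriv ((Q a₀ b₀) t) x ^ 2 + V x * (Q a₀ b₀) t x ^ 2)) := by
          rw [lintegral_add_left ((hmeasψ t).const_mul _), lintegral_const_mul _ (hmeasψ t),
            lintegral_const_mul' _ _ (by norm_num)]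
  have hΛpφ := hΛφ atTop (hQen a₀ b₀ ρ hρx).1
  have hΛmφ := hΛφ atBot (hQen a₀ b₀ ρ hρx).2.1
  -- everything is finite: pass to real numbers
  set eφ : ℝ := ∫ x in Ioi ρ, (deriv (fun τ => φ τ x) 0 ^ 2 + deriv (φ 0) x ^ 2 + V x * φ 0 x ^ 2) with heφ
  have heφ0 : 0 ≤ eφ := setIntegral_nonneg measurableSet_Ioi fun x _ =>
    wave1D_energyDensity_nonneg hV0 0 x
  have hR : DQ ≤ ENNReal.ofReal (C₁ * θ) + ENNReal.ofReal C₂ * (2 * Λp + 2 * Λm)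
      + ENNReal.ofReal (C₃ * eφ / ρ) := by
    refine hDQle.trans (hlhs.le.trans (hstep.trans ?_))
    have hC₂le : ENNReal.ofReal (24 * C_A * (1 + Kf)) ≤ ENNReal.ofReal C₂ :=
      ENNReal.ofReal_le_ofReal (by simp only [hC₂]; linarith)
    exact add_le_add (add_le_add le_rfl (mul_le_mul' hC₂le (add_le_add hΛpφ hΛmφ))) le_rfl
  -- pass to real numbers
  set lp : ℝ := Λp.toReal with hlp
  set lm : ℝ := Λm.toReal with hlm
  set dq : ℝ := DQ.toReal with hdq
  have hlp0 : 0 ≤ lp := ENNReal.toReal_nonneg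
  have hlm0 : 0 ≤ lm := ENNReal.toReal_nonneg
  have hΛp_eq : Λp = ENNReal.ofReal lp := (ENNReal.ofReal_toReal hΛptop).symm
  have hΛm_eq : Λm = ENNReal.ofReal lm := (ENNReal.ofReal_toReal hΛmtop).symm
  have h2 : (2 : ENNReal) = ENNReal.ofReal 2 := by norm_num
  have n1 : 0 ≤ C₁ * θ := mul_nonneg hC₁0.le hθpos.le
  have n2lp : 0 ≤ 2 * lp := mul_nonneg zero_le_two hlp0
  have n2lm : 0 ≤ 2 * lm := mul_nonneg zero_le_two hlm0
  have n2 : 0 ≤ C₂ * (2 * lp + 2 * lm) := mul_nonneg hC₂0.le (add_nonneg n2lp n2lm)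
  have n3 : 0 ≤ C₃ * eφ / ρ := div_nonneg (mul_nonneg hC₃0 heφ0) hρ0.le
  have hRHS : ENNReal.ofReal (C₁ * θ) + ENNReal.ofReal C₂ * (2 * Λp + 2 * Λm)
      + ENNReal.ofReal (C₃ * eφ / ρ)
      = ENNReal.ofReal (C₁ * θ + C₂ * (2 * lp + 2 * lm) + C₃ * eφ / ρ) := by
    rw [hΛp_eq, hΛm_eq, h2, ← ENNReal.ofReal_mul zero_le_two, ← ENNReal.ofReal_mul zero_le_two,
      ← ENNReal.ofReal_add n2lp n2lm, ← ENNReal.ofReal_mul hC₂0.le,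
      ← ENNReal.ofReal_add n1 n2, ← ENNReal.ofReal_add (add_nonneg n1 n2) n3]
  have hdqR : dq ≤ C₁ * θ + C₂ * (2 * lp + 2 * lm) + C₃ * eφ / ρ := by
    have h := hR
    rw [hRHS] at h
    have h' := ENNReal.toReal_mono ENNReal.ofReal_ne_top h
    rwa [ENNReal.toReal_ofReal (add_nonneg (add_nonneg n1 n2) n3)] at h'
  -- the initial energy of `φ` against `DQ`
  have heφle : eφ ≤ dq + (ε : ℝ) / 2 := by
    have hε2top : (ε : ENNReal) / 2 ≠ ⊤ := (ENNReal.div_lt_top ENNReal.coe_ne_top two_ne_zero).ne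
    have h1 : ENNReal.ofReal eφ < DQ + (ε : ENNReal) / 2 := by rw [hφeq]; exact hlt
    have htop2 : DQ + (ε : ENNReal) / 2 ≠ ⊤ := ENNReal.add_ne_top.2 ⟨hDQtop.ne, hε2top⟩
    have h3 := ENNReal.toReal_mono htop2 h1.le
    rw [ENNReal.toReal_ofReal heφ0, ENNReal.toReal_add hDQtop.ne hε2top, ENNReal.toReal_div,
      ENNReal.coe_toReal] at h3
    norm_num at h3
    exact h3
  have hC₃ρ : C₃ * eφ / ρ ≤ eφ / 2 := by
    rw [div_le_div_iff₀ hρ0 two_pos]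
    have := mul_le_mul_of_nonneg_left hρC heφ0
    linarith only [this, heφ0]
  have hθval : C₁ * θ = (ε : ℝ) / 4 := by
    simp only [hθ]; field_simp
  have hdq_final : dq ≤ 4 * C₂ * (lp + lm) + (ε : ℝ) := by
    linarith only [hdqR, hC₃ρ, heφle, hθval]
  have n4 : 0 ≤ 4 * C₂ := mul_nonneg (by norm_num) hC₂0.le
  have n5 : 0 ≤ 4 * C₂ * (lp + lm) := mul_nonneg n4 (add_nonneg hlp0 hlm0)
  calc DQ = ENNReal.ofReal dq := (ENNReal.ofReal_toReal hDQtop.ne).symm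
    _ ≤ ENNReal.ofReal (4 * C₂ * (lp + lm) + ε) := ENNReal.ofReal_le_ofReal hdq_final
    _ = ENNReal.ofReal (4 * C₂) * (Λp + Λm) + ε := by
        rw [ENNReal.ofReal_add n5 (NNReal.coe_nonneg ε), ENNReal.ofReal_mul n4,
          ENNReal.ofReal_add hlp0 hlm0, ← hΛp_eq, ← hΛm_eq, ENNReal.ofReal_coe_nnreal]

end Literature.Analysis.PDE
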